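import Literature.NumberTheory.LFunctions.WeilTwoPrimeCellsT80
import Literature.NumberTheory.LFunctions.WeilTwoPrimeMinorant
import Literature.NumberTheory.LFunctions.WeilTwoPrimeCellsT80NuPart4
import HarnessLib

/-!
# Two-prime minorant cells on `[0, 80]`: kernel facts for the partial moment sums, group 35

`cellsMomentQ₂₃ wL chunk q = nuPartT80_t_q` by `decide +kernel`, one declaration per (chunk, q). Pure proof file.
-/

noncomputable section

namespace Literature.NumberTheory.LFunctions

set_option maxHeartbeats 0 in
/-- The partial moment sum over chunk 0 at `q = 140`. [folklore] -/
theorem nuPartT80_0_140_eq :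
    cellsMomentQ₂₃ weilTwoPrimeCellsT80Level weilTwoPrimeCellsT80C0 140 = nuPartT80_0_140 := by
  decide +kernel

set_option maxHeartbeats 0 in
/-- The partial moment sum over chunk 1 at `q = 140`. [folklore] -/
theorem nuPartT80_1_140_eq :
    cellsMomentQ₂₃ weilTwoPrimeCellsT80Level (weilTwoPrimeCellsT80C1.take 53) 140 = nuPartT80_1_140 := by
  decide +kernel

set_option maxHeartbeats 0 in
/-- The partial moment sum over chunk 2 at `q = 140`. [folklore] -/
theorem nuPartT80_2_140_eq :
    cellsMomentQ₂₃ weilTwoPrimeCellsT80Level (weilTwoPrimeCellsT80C1.drop 53) 140 = nuPartT80_2_140 := by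
  decide +kernel

set_option maxHeartbeats 0 in
/-- The partial moment sum over chunk 3 at `q = 140`. [folklore] -/
theorem nuPartT80_3_140_eq :
    cellsMomentQ₂₃ weilTwoPrimeCellsT80Level weilTwoPrimeCellsT80C2 140 = nuPartT80_3_140 := by
  decide +kernel

set_option maxHeartbeats 0 in
/-- The partial moment sum over chunk 0 at `q = 142`. [folklore] -/
theorem nuPartT80_0_142_eq :
    cellsMomentQ₂₃ weilTwoPrimeCellsT80Level weilTwoPrimeCellsT80C0 142 = nuPartT80_0_142 := by
  decide +kernel

set_option maxHeartbeats 0 in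
/-- The partial moment sum over chunk 1 at `q = 142`. [folklore] -/
theorem nuPartT80_1_142_eq :
    cellsMomentQ₂₃ weilTwoPrimeCellsT80Level (weilTwoPrimeCellsT80C1.take 53) 142 = nuPartT80_1_142 := by
  decide +kernel

set_option maxHeartbeats 0 in
/-- The partial moment sum over chunk 2 at `q = 142`. [folklore] -/
theorem nuPartT80_2_142_eq :
    cellsMomentQ₂₃ weilTwoPrimeCellsT80Level (weilTwoPrimeCellsT80C1.drop 53) 142 = nuPartT80_2_142 := by
  decide +kernel

set_option maxHeartbeats 0 in
/-- The partial moment sum over chunk 3 at `q = 142`. [folklore] -/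
theorem nuPartT80_3_142_eq :
    cellsMomentQ₂₃ weilTwoPrimeCellsT80Level weilTwoPrimeCellsT80C2 142 = nuPartT80_3_142 := by
  decide +kernel


end Literature.NumberTheory.LFunctions
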